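import Summits.BirchSwinnertonDyer.BirchSwinnertonDyer.Theorems.EisensteinPrimesB11DescentCertificate
import Summits.BirchSwinnertonDyer.BirchSwinnertonDyer.Theorems.EisensteinPrimesB11NonsplitLamMin10032k1
import Literature.NumberTheory.EllipticCurves.ThreeIsogeny
import Literature.NumberTheory.EllipticCurves.IsogenyVariableChangeProofs
import Literature.NumberTheory.EllipticCurves.IsogenyQuadraticTwistProofs
import HarnessLib

/-!
# Row B11 per pair, PREPRINT-FREE descent road — display `10032k1 @ 3` (nonsplit-GV window cell), DIRECT and ISOGENOUS forms:
# `BSD(10032k1, 3)` from Gross–Zagier–Kolyvagin alone + the two READS (cell `bsd-eis`, seat `bsd-eis-k5-p4` g0; door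
# `Theorems/EisensteinPrimesB11DescentCertificate.lean` p536512; RULING L76 gate (G3); THEOREMS ONLY — nothing booked)

HONEST FRAMING (FULL-BSD rank-≤1 programme D-0033, cell `bsd-eis`, run/shared/lean/pub/bsd-eis/; row B11 = X2c = `CellC`:
`r_an = 1`, `p ‖ N`, `E[p]` reducible; crux 4 `BSDpOnCellC` stmt-BirchSwinnertonDyer-19034 stays OPEN; no label or count moves;
BSD is proved for no curve unconditionally). This file instantiates the GZK-only door `X2.cellC_bsdp_of_shaAn_unit_of_noPTorsion`
(and its `_of_isIsogenous` form) at ONE window cell of the class-wide table `pub/bsd-eis/k5-p4-g0/B11-DESC3R1-TABLE-v1.tsv`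
(3ba341440843231c; row `10032k @3`: VERDICT `CERT`, record `10032k1`, kernel `x + 176`, `(s_φ̂, s_φ, m, EXCESS) = (0, 1, 1, 0)` on
`isogchi` ‖ `isogcft` IDENTICAL; member `10032k2`: `(1, 0, 1, 0)` IDENTICAL; `#Ш_an = 1` on both members, Cremona `allbsd` = PARI leg).

TARGET `W = 10032k1 = [0, -1, 0, -182704, -30452288]` (Cremona reduced minimal; `N = 10032 = 2⁴·3·11·19`); class `10032k` =
{`10032k1`, `10032k2 = [0, -1, 0, 711536, -145692608]`} joined by a `3`-isogeny with kernel `x₀ = -176` on `10032k1`.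
**IN THE KERNEL:** `ClassX2 10032k1 3`, ellipticity and minimality of `10032k1` are IMPORTED BY NAME from k5-c4's λ-minimal display
`Theorems/EisensteinPrimesB11NonsplitLamMin10032k1.lean` (`classX2_10032k1`, `isElliptic_10032k1`, `isGloballyMinimal_10032k1` — not
restated); NEW here: §1 `10032k2` elliptic + globally minimal (bounded Kraus criterion), §2 the `3`-isogeny `10032k1 ∼ 10032k2` over `ℚ`
(`⟨1, -176, 0, 0⟩ • 10032k1 = E_{m,s}^{(d)}` with `(m, s, d) = (23, -1944, -1)`, Vélu `E_{m,s} ∼ E_{m,s}/⟨T⟩` twisted by `d`,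
`⟨1, 176, 0, 0⟩ • (E_{m,s}/⟨T⟩)^{(d)} = 10032k2`; the pattern of `X1/SecondDescentDisplay296450jp.lean` §2).
**READ (hypotheses; instrument data, nothing asserted):** `hr : r_an(10032k1) = 1` (Cremona; PARI `ellanalyticrank`), `hq`/`hv` :
`#Ш_an = q`, `ord₃ q = 0` (Cremona `allbsd` 1.0 ‖ PARI `L'(E,1)/(ellbsd·ĥ(P_sat))` = 1, kit j280759), `h : Ш[3] = 0` (EXCESS `= 0` on both
isogeny-descent engines ⇒ `Ш(10032k1)[φ] = Ш(10032k2)[φ̂] = 0` ⇒ `Ш[3] = 0` on both members). **PUBLISHED facts BY NAME:** `hGZK`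
(Gross–Zagier–Kolyvagin, bsd.S17); on the isogenous form also `hmod` (modularity), `hCassels` (Cassels 1965 / Milne ADT I.7.3). No Iwasawa
theory, no preprint, no `_OPEN` fact, no `@[conjecture]`.

What this is NOT: not a booking of `(10032k1, 3)` (referee B's word); not crux 4 (the CLASS); the cell ALSO has the λ-minimal display
(k5-c4, road `T-EISX2LM1`) — this is a SECOND, mechanism-disjoint road at the same pair.
Refs: [Miller2011LMS] Def. 1.1; [MilneADT2006] Thm. I.7.3; [CremonaAlgorithms1997] §3.8 (Vélu); [SilvermanAEC2009] III.4, VII.1 Rem. 1.1,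
X.4.2; [Kraus1989] Prop. 1–2; Cremona `ecdata` class 10032k.
-/

set_option autoImplicit false
set_option linter.dupNamespace false

noncomputable section

open scoped Classical

open WeierstrassCurve NumberField IsDedekindDomain
  Literature.NumberTheory.EllipticCurves
  Literature.NumberTheory.EllipticCurves.ModularForms
  Literature.NumberTheory.EllipticCurves.Rank1Residual
  Literature.NumberTheory.EllipticCurves.Rank1Residual.Typed
  Summit.BirchSwinnertonDyer.BirchSwinnertonDyer.Rank1Residual.IntModel
  Summit.BirchSwinnertonDyer.Rank1Residual.X11b
  Summit.BirchSwinnertonDyer.Rank1Residual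
  Summit.BirchSwinnertonDyer.Rank1Residual.X2
  Summit.BirchSwinnertonDyer.BirchSwinnertonDyer.Theorems.B11NonsplitLamMin10032k1
  Summit.BirchSwinnertonDyer.BirchSwinnertonDyer.Theorems.B11DescentCertificate

namespace Summit.BirchSwinnertonDyer.BirchSwinnertonDyer.Theorems.B11Descent10032k1

/-! ## §1 The isogenous member `10032k2 = [0, -1, 0, 711536, -145692608]`: elliptic, globally minimal -/

/-- `10032k2` is elliptic (`Δ = -32195204388079755264 ≠ 0`). [folklore] -/
theorem isElliptic_10032k2 : (⟨0, (-1), 0, 711536, (-145692608)⟩ : WeierstrassCurve ℚ).IsElliptic :=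
  isElliptic_of_discOf_ne_zero 0 (-1) 0 711536 (-145692608) (by decide +kernel)

set_option maxRecDepth 100000 in
/-- `10032k2` is globally minimal (bounded Kraus criterion: `|Δ| = 2¹³·3⁵·11·19³… < 512¹²`; at `2`: `2²⁴ ∤ Δ`, `c₆ = 64·u` with
`u ≡ 1 (mod 4)`; trial division below 512). [cite: SilvermanAEC2009, VII.1 Remark 1.1] [cite: Kraus1989, Prop. 1 and Prop. 2] -/
theorem isGloballyMinimal_10032k2 : (⟨0, (-1), 0, 711536, (-145692608)⟩ : WeierstrassCurve ℚ).IsGloballyMinimal :=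
  isGloballyMinimal_of_krausCriterion_bounded₃ 0 (-1) 0 711536 (-145692608)
    (by decide +kernel) (by decide +kernel) (by decide +kernel)

/-! ## §2 The `3`-isogeny `10032k1 ∼ 10032k2` over `ℚ` in the kernel (Vélu) -/

/-- **`⟨1, -176, 0, 0⟩ • 10032k1 = E_{m,s}^{(d)}`** with `(m, s, d) = (23, -1944, -1)`: translating the rational `Ψ₃`-root `x₀ = -176`
to `0` puts `10032k1` in the form `y² = x³ + d(mx + ds)²`, the twist by `d = -1` of the tree's three-torsion model `[0, m², 0, 2ms, s²]`
(the kernel point `T` is defined over `ℚ(i)`). [folklore] -/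
theorem smul_10032k1_eq_threeTorsionModel :
    (⟨1, -176, 0, 0⟩ : VariableChange ℚ) • (⟨0, (-1), 0, (-182704), (-30452288)⟩ : WeierstrassCurve ℚ) =
      (threeTorsionModel (23 : ℚ) (-1944 : ℚ)).quadraticTwist (-1 : ℚ) := by
  ext <;> simp only [variableChange_a₁, variableChange_a₂, variableChange_a₃, variableChange_a₄, variableChange_a₆,
    quadraticTwist_a₁, quadraticTwist_a₂, quadraticTwist_a₃, quadraticTwist_a₄, quadraticTwist_a₆, WeierstrassCurve.b₂,
    WeierstrassCurve.b₄, WeierstrassCurve.b₆, threeTorsionModel_a₁, threeTorsionModel_a₂, threeTorsionModel_a₃,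
    threeTorsionModel_a₄, threeTorsionModel_a₆, inv_one, Units.val_one] <;> norm_num

/-- **`⟨1, 176, 0, 0⟩ • ((E_{m,s}/⟨T⟩)^{(d)}) = 10032k2`**: Vélu's quotient `[0, m², 0, −18ms, −(27s² + 16m³s)]` twisted by `d = -1`
against Cremona's minimal model of `10032k2`. [cite: CremonaAlgorithms1997, §3.8 (Vélu's formulae)] -/
theorem smul_threeIsogenyCodomain_eq_10032k2 :
    (⟨1, 176, 0, 0⟩ : VariableChange ℚ) • (threeIsogenyCodomain (23 : ℚ) (-1944 : ℚ)).quadraticTwist (-1 : ℚ) =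
      (⟨0, (-1), 0, 711536, (-145692608)⟩ : WeierstrassCurve ℚ) := by
  ext <;> simp only [variableChange_a₁, variableChange_a₂, variableChange_a₃, variableChange_a₄, variableChange_a₆,
    quadraticTwist_a₁, quadraticTwist_a₂, quadraticTwist_a₃, quadraticTwist_a₄, quadraticTwist_a₆, WeierstrassCurve.b₂,
    WeierstrassCurve.b₄, WeierstrassCurve.b₆, threeIsogenyCodomain_a₁, threeIsogenyCodomain_a₂, threeIsogenyCodomain_a₃,
    threeIsogenyCodomain_a₄, threeIsogenyCodomain_a₆, inv_one, Units.val_one] <;> norm_num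

/-- **`10032k1 ∼ 10032k2` over `ℚ`** (isomorphism · Vélu `3`-isogeny twisted by `-1` · isomorphism; `IsIsogenous.trans'`).
[cite: CremonaAlgorithms1997, §3.8 (Vélu's formulae)] [cite: SilvermanAEC2009, III.3.1(b), III.4] -/
theorem isIsogenous_10032k1_10032k2 :
    IsIsogenous (⟨0, (-1), 0, (-182704), (-30452288)⟩ : WeierstrassCurve ℚ) (⟨0, (-1), 0, 711536, (-145692608)⟩ : WeierstrassCurve ℚ) := by
  have hΔ : (threeTorsionModel (23 : ℚ) (-1944 : ℚ)).Δ ≠ 0 := by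
    rw [Δ_threeTorsionModel]; norm_num
  exact ((isIsogenous_of_smul_eq smul_10032k1_eq_threeTorsionModel).trans'
    ((isIsogenous_threeTorsionModel_threeIsogenyCodomain hΔ).quadraticTwist (d := (-1 : ℚ)) (by norm_num))).trans'
    (isIsogenous_of_smul_eq smul_threeIsogenyCodomain_eq_10032k2)

/-! ## §3 The displays: `BSD(10032k1, 3)` from GZK + the two reads, directly and through the isogenous member -/

/-- **X2c INSTANCE, DESCENT ROAD — `BSD(10032k1, 3)`** from Gross–Zagier–Kolyvagin (`hGZK`) and the two READS on `10032k1` itself: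
`hq`/`hv` (`#Ш_an(10032k1)` is a rational of `3`-adic valuation `0`) and `h` (`Ш(10032k1)[3] = 0`: EXCESS `= 0` on `isogchi` ‖ `isogcft`),
through `X2.cellC_bsdp_of_shaAn_unit_of_noPTorsion`; `CellC 10032k1 3` = `⟨hr, classX2_10032k1⟩` with k5-c4's kernel-proved `ClassX2`.
No other binder. Nothing booked. [cite: Miller2011LMS, §1 and Def. 1.1] -/
theorem bsdp_10032k1_at_three_of_descent (hGZK : rank_eq_analyticRank_of_analyticRank_le_one)
    (W : WeierstrassCurve ℚ) [W.IsElliptic] [W.IsGloballyMinimal] (hW : W = ⟨0, (-1), 0, (-182704), (-30452288)⟩)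
    (hr : W.analyticRank = 1) {q : ℚ} (hq : shaAn W = (q : ℂ)) (hv : padicValRat 3 q = 0)
    (h : ∀ x : W.sha, (3 : ℤ) • x = 0 → x = 0) : BSDp W 3 := by
  subst hW
  exact X2.cellC_bsdp_of_shaAn_unit_of_noPTorsion _ 3 hGZK ⟨hr, classX2_10032k1⟩ hq hv h

/-- **The same on the route's cell predicate**: `CellC 10032k1 3 → BSD(10032k1, 3)` modulo GZK and the two reads — crux 4's
`X2.TargetC` shape at this pair. [cite: Miller2011LMS, §1 and Def. 1.1] -/
theorem targetC_10032k1_at_three_of_descent (hGZK : rank_eq_analyticRank_of_analyticRank_le_one)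
    (W : WeierstrassCurve ℚ) [W.IsElliptic] [W.IsGloballyMinimal] (hW : W = ⟨0, (-1), 0, (-182704), (-30452288)⟩)
    {q : ℚ} (hq : shaAn W = (q : ℂ)) (hv : padicValRat 3 q = 0) (h : ∀ x : W.sha, (3 : ℤ) • x = 0 → x = 0) :
    CellC W 3 → BSDp W 3 :=
  fun hc ↦ bsdp_10032k1_at_three_of_descent hGZK W hW hc.1 hq hv h

/-- **X2c INSTANCE, DESCENT ROAD THROUGH THE ISOGENOUS MEMBER (RULING L76 (G3) `_of_isIsogenous` row) — `BSD(10032k1, 3)`** from GZK,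
modularity, Cassels' isogeny invariance and the two READS on `10032k2` (`#Ш_an(10032k2) = q'` with `ord₃ q' = 0`; `Ш(10032k2)[3] = 0`),
through `X2.cellC_bsdp_of_shaAn_unit_of_noPTorsion_of_isIsogenous` with the kernel-proved `3`-isogeny `isIsogenous_10032k1_10032k2` (§2).
Nothing booked. [cite: MilneADT2006, Thm. I.7.3] [cite: Miller2011LMS, §1 and Def. 1.1] -/
theorem bsdp_10032k1_at_three_of_descent_on_10032k2 (hGZK : rank_eq_analyticRank_of_analyticRank_le_one)
    (hmod : hasEntireLFunction_rat) (hCassels : bsdRHS_eq_of_isIsogenous)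
    (W : WeierstrassCurve ℚ) [W.IsElliptic] [W.IsGloballyMinimal] (hW : W = ⟨0, (-1), 0, (-182704), (-30452288)⟩)
    (hr : W.analyticRank = 1)
    (W' : WeierstrassCurve ℚ) [W'.IsElliptic] [W'.IsGloballyMinimal] (hW' : W' = ⟨0, (-1), 0, 711536, (-145692608)⟩)
    {q' : ℚ} (hq' : shaAn W' = (q' : ℂ)) (hv' : padicValRat 3 q' = 0)
    (h' : ∀ x : W'.sha, (3 : ℤ) • x = 0 → x = 0) : BSDp W 3 := by
  subst hW hW'
  exact X2.cellC_bsdp_of_shaAn_unit_of_noPTorsion_of_isIsogenous _ 3 hGZK hmod hCassels ⟨hr, classX2_10032k1⟩ _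
    isIsogenous_10032k1_10032k2 hq' hv' h'

/-- **Both members at once** — `BSD(10032k1, 3) ∧ BSD(10032k2, 3)` from GZK + modularity + Cassels + the two reads on `10032k2`
(`X2.cellC_bsdp_pair_of_shaAn_unit_of_noPTorsion`). Nothing booked. [cite: MilneADT2006, Thm. I.7.3] [cite: Miller2011LMS, Def. 1.1] -/
theorem bsdp_pair_10032k_at_three_of_descent (hGZK : rank_eq_analyticRank_of_analyticRank_le_one)
    (hmod : hasEntireLFunction_rat) (hCassels : bsdRHS_eq_of_isIsogenous)
    (W : WeierstrassCurve ℚ) [W.IsElliptic] [W.IsGloballyMinimal] (hW : W = ⟨0, (-1), 0, (-182704), (-30452288)⟩)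
    (hr : W.analyticRank = 1)
    (W' : WeierstrassCurve ℚ) [W'.IsElliptic] [W'.IsGloballyMinimal] (hW' : W' = ⟨0, (-1), 0, 711536, (-145692608)⟩)
    {q' : ℚ} (hq' : shaAn W' = (q' : ℂ)) (hv' : padicValRat 3 q' = 0)
    (h' : ∀ x : W'.sha, (3 : ℤ) • x = 0 → x = 0) : BSDp W 3 ∧ BSDp W' 3 := by
  subst hW hW'
  exact X2.cellC_bsdp_pair_of_shaAn_unit_of_noPTorsion _ 3 hGZK hmod hCassels ⟨hr, classX2_10032k1⟩ _
    isIsogenous_10032k1_10032k2 hq' hv' h'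

end Summit.BirchSwinnertonDyer.BirchSwinnertonDyer.Theorems.B11Descent10032k1

end
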